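import Summits.AtomisticToContinuum.BoseEinsteinCondensation.Theorems.BECInsertionCorrectorCorrectorClosureFirstCorrectorBoundModes
import Summits.AtomisticToContinuum.BoseEinsteinCondensation.Theorems.BECInsertionCorrectorCorrectorClosureFirstCorrectorBoundDictionary
import Summits.AtomisticToContinuum.BoseEinsteinCondensation.Theorems.BECInsertionCorrectorCorrectorClosureTailModes
import HarnessLib

/-!
# Crux `CorrectorClosure` (stmt-AtomisticToContinuum-12058), line `residue-area-law` —
# stub `stub_firstCorrectorBound`, auxiliary file 5: the `N`-uniform bound of the finite mode sums

Supports (does not close) stmt-AtomisticToContinuum-12058, route `BECInsertionCorrector`.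
Theorems only. If the bath density waves of every frequency `k ≠ 0` have
`‖∑ⱼcos(p_k·xⱼ)‖²₋₁, ‖∑ⱼ sin(p_k·xⱼ)‖²₋₁ ≤ C_K N/|p_k|²` (the per-mode dictionary), then for real
coefficients `α_k, β_k` and a finite `S ∌ 0` without antipodal pairs the tagged-mode sum
`M(X) = ∑_{k ∈ S} (a_k(X') cos(p_k·y) + b_k(X') sin(p_k·y))`, `a_k = 2(α_k∑ⱼcos + β_k∑ⱼsin)`,
`b_k = 2(α_k∑ⱼsin - β_k∑ⱼcos)`, satisfies
`‖M‖²₋₁ ≤ (2 C_K N L⁵/π²) ∑_{k ∈ S} (α_k² + β_k²)/|k|²` (`hMinusOneSqW_tail_modes_le` and the coefficient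
bound `‖a_k‖², ‖b_k‖² ≤ 8(α_k² + β_k²) C_K N/|p_k|²`), hence, if `α_k² + β_k² = c_k²` with `|c_k| ≤ A` and
`∑_T c_k² ≤ P`, `‖M‖²₋₁ ≤ (2C_K N L⁵/π²)(96⌈L⌉A² + P/⌈L⌉²)` (the lattice sum at `K₀ = ⌈L⌉`); and the
arithmetic `(2C_K N L⁵/π²)(96⌈L⌉(L⁻³κ)² + L⁻³C_Uκ/⌈L⌉²) ≤ C_K(192κ² + C_Uκ)N` for `L ≥ 1`.
-/

noncomputable section

open MeasureTheory Filter Matrix Finset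
open scoped ENNReal NNReal BigOperators

namespace Summit.AtomisticToContinuum.BoseEinsteinCondensation.Theorems.CorrectorClosure.ResidueAreaLaw

open Literature.MathematicalPhysics.QuantumManyBody.BoseGas
open Summit.AtomisticToContinuum.BoseEinsteinCondensation.Theorems.CorrectorClosure.HealingScaleKacInsertion
  (hMinusOneSqW_tail_modes_le)

variable {N : ℕ} {L : ℝ}

/-- `|k|² = ∑ᵢ kᵢ² > 0` for `k ≠ 0`. [folklore] -/
theorem nsq_pos_of_ne_zero {k : Fin 3 → ℤ} (hk : k ≠ 0) : 0 < ∑ i, (k i : ℝ) ^ 2 := by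
  have h1 : (1 : ℝ) ≤ ((univ.sup fun j => (k j).natAbs : ℕ) : ℝ) := by
    exact_mod_cast one_le_supNorm_of_ne_zero hk
  nlinarith [supNorm_sq_le_nsq k]

/-! ### Density waves, mode coefficients and mode sums are continuous -/

/-- The density waves `X' ↦ ∑ⱼ f(p_k·xⱼ)` are continuous for continuous `f`. [folklore] -/
theorem continuous_densityWave (L : ℝ) (k : Fin 3 → ℤ) {f : ℝ → ℝ} (hf : Continuous f) :
    Continuous fun Z : Config N => ∑ j, f (2 * Real.pi / L * ∑ i, (k i : ℝ) * Z j i) := by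
  refine continuous_finsetSum _ fun j _ => hf.comp (continuous_const.mul
    (continuous_finsetSum _ fun i _ => continuous_const.mul ?_))
  exact (PiLp.continuous_apply 2 _ i).comp (continuous_apply j)

/-- The tagged-mode coefficient `2(α ∑ⱼ f(p_k·xⱼ) + β ∑ⱼ g(p_k·xⱼ))` is continuous. [folklore] -/
theorem continuous_modeCoeff (L : ℝ) (k : Fin 3 → ℤ) (α β : ℝ) {f g : ℝ → ℝ} (hf : Continuous f)
    (hg : Continuous g) :
    Continuous fun Z : Config N => 2 * (α * ∑ j, f (2 * Real.pi / L * ∑ i, (k i : ℝ) * Z j i) +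
      β * ∑ j, g (2 * Real.pi / L * ∑ i, (k i : ℝ) * Z j i)) :=
  continuous_const.mul ((continuous_const.mul (continuous_densityWave L k hf)).add
    (continuous_const.mul (continuous_densityWave L k hg)))

/-- The tagged-mode sums are continuous on the `(N+1)`-torus. [folklore] -/
theorem continuous_modes (L : ℝ) (S : Finset (Fin 3 → ℤ)) (α β : (Fin 3 → ℤ) → ℝ) :
    Continuous fun X : Config (N + 1) => ∑ k ∈ S,
      (2 * (α k * ∑ j, Real.cos (2 * Real.pi / L * ∑ i, (k i : ℝ) * vecTail X j i) +
            β k * ∑ j, Real.sin (2 * Real.pi / L * ∑ i, (k i : ℝ) * vecTail X j i)) *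
          Real.cos (2 * Real.pi / L * ∑ i, (k i : ℝ) * X 0 i) +
        2 * (α k * ∑ j, Real.sin (2 * Real.pi / L * ∑ i, (k i : ℝ) * vecTail X j i) -
            β k * ∑ j, Real.cos (2 * Real.pi / L * ∑ i, (k i : ℝ) * vecTail X j i)) *
          Real.sin (2 * Real.pi / L * ∑ i, (k i : ℝ) * X 0 i)) := by
  have ht := HealingScaleKacInsertion.continuous_vecTail_config (N := N)
  have hB : ∀ k : Fin 3 → ℤ, Continuous fun Z : Config N =>
      2 * (α k * ∑ j, Real.sin (2 * Real.pi / L * ∑ i, (k i : ℝ) * Z j i) -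
        β k * ∑ j, Real.cos (2 * Real.pi / L * ∑ i, (k i : ℝ) * Z j i)) := fun k => by
    simpa only [sub_eq_add_neg, neg_mul] using
      continuous_modeCoeff (N := N) L k (α k) (-β k) Real.continuous_sin Real.continuous_cos
  refine continuous_finsetSum _ fun k _ => ?_
  exact (((continuous_modeCoeff L k (α k) (β k) Real.continuous_cos Real.continuous_sin).comp ht).mul
    ((HealingScaleKacInsertion.continuous_cos_modePhase L k).comp (continuous_apply 0))).add
    (((hB k).comp ht).mul
      ((HealingScaleKacInsertion.continuous_sin_modePhase L k).comp (continuous_apply 0)))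

/-- **The tagged-mode sums in terms of the lattice sum.** Under the per-mode dictionary with
constant `C_K ≥ 0`, for real coefficients `α, β` and a finite `S ∌ 0` without antipodal pairs,
`‖∑_{k ∈ S} (a_k cos(p_k·y) + b_k sin(p_k·y))‖²₋₁ ≤ (2 C_K N L⁵/π²) ∑_{k ∈ S} (α_k² + β_k²)/|k|²`.
[folklore] -/
theorem hMinusOneSqW_modes_le_latticeSum (hL : 0 < L) {Θ₀ : Config N → ℝ} (hΘc : Continuous Θ₀)
    {CK : ℝ} (hCK : 0 ≤ CK)
    (hdict : ∀ k : Fin 3 → ℤ, k ≠ 0 →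
      hMinusOneSqW L Θ₀
          (fun X : Config N => ∑ j, Real.cos (2 * Real.pi / L * ∑ i, (k i : ℝ) * X j i)) ≤
        ENNReal.ofReal (CK * N / ((2 * Real.pi / L) ^ 2 * ∑ i, (k i : ℝ) ^ 2)) ∧
      hMinusOneSqW L Θ₀
          (fun X : Config N => ∑ j, Real.sin (2 * Real.pi / L * ∑ i, (k i : ℝ) * X j i)) ≤
        ENNReal.ofReal (CK * N / ((2 * Real.pi / L) ^ 2 * ∑ i, (k i : ℝ) ^ 2)))
    {S : Finset (Fin 3 → ℤ)} (hS0 : (0 : Fin 3 → ℤ) ∉ S) (hS : ∀ m ∈ S, -m ∉ S)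
    (α β : (Fin 3 → ℤ) → ℝ) :
    hMinusOneSqW L (fun X : Config (N + 1) => Θ₀ (vecTail X))
        (fun X : Config (N + 1) => ∑ k ∈ S,
          (2 * (α k * ∑ j, Real.cos (2 * Real.pi / L * ∑ i, (k i : ℝ) * vecTail X j i) +
                β k * ∑ j, Real.sin (2 * Real.pi / L * ∑ i, (k i : ℝ) * vecTail X j i)) *
              Real.cos (2 * Real.pi / L * ∑ i, (k i : ℝ) * X 0 i) +
            2 * (α k * ∑ j, Real.sin (2 * Real.pi / L * ∑ i, (k i : ℝ) * vecTail X j i) -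
                β k * ∑ j, Real.cos (2 * Real.pi / L * ∑ i, (k i : ℝ) * vecTail X j i)) *
              Real.sin (2 * Real.pi / L * ∑ i, (k i : ℝ) * X 0 i))) ≤
      ENNReal.ofReal (2 * CK * N * L ^ 5 / Real.pi ^ 2 *
        ∑ k ∈ S, (α k ^ 2 + β k ^ 2) / ∑ i, (k i : ℝ) ^ 2) := by
  -- Step 1: orthogonality of the tagged modes
  have h1 := hMinusOneSqW_tail_modes_le N L hL Θ₀ hΘc S hS0 hS
    (fun k Z => 2 * (α k * ∑ j, Real.cos (2 * Real.pi / L * ∑ i, (k i : ℝ) * Z j i) +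
      β k * ∑ j, Real.sin (2 * Real.pi / L * ∑ i, (k i : ℝ) * Z j i)))
    (fun k Z => 2 * (α k * ∑ j, Real.sin (2 * Real.pi / L * ∑ i, (k i : ℝ) * Z j i) -
      β k * ∑ j, Real.cos (2 * Real.pi / L * ∑ i, (k i : ℝ) * Z j i)))
    (fun k _ => continuous_modeCoeff L k (α k) (β k) Real.continuous_cos Real.continuous_sin)
    (fun k _ => by
      simpa only [sub_eq_add_neg, neg_mul] using
        continuous_modeCoeff L k (α k) (-β k) Real.continuous_sin Real.continuous_cos)
  refine h1.trans ?_
  -- Step 2: the coefficient bound, mode by mode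
  set M : (Fin 3 → ℤ) → ℝ := fun k => CK * N / ((2 * Real.pi / L) ^ 2 * ∑ i, (k i : ℝ) ^ 2) with hM
  have hne : ∀ k ∈ S, k ≠ 0 := fun k hk h => hS0 (h ▸ hk)
  have hM0 : ∀ k ∈ S, 0 ≤ M k := fun k hk => by
    have := nsq_pos_of_ne_zero (hne k hk)
    rw [hM]; positivity
  have h2 : ∀ k ∈ S,
      hMinusOneSqW L Θ₀ (fun Z : Config N =>
          2 * (α k * ∑ j, Real.cos (2 * Real.pi / L * ∑ i, (k i : ℝ) * Z j i) +
            β k * ∑ j, Real.sin (2 * Real.pi / L * ∑ i, (k i : ℝ) * Z j i))) +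
        hMinusOneSqW L Θ₀ (fun Z : Config N =>
          2 * (α k * ∑ j, Real.sin (2 * Real.pi / L * ∑ i, (k i : ℝ) * Z j i) -
            β k * ∑ j, Real.cos (2 * Real.pi / L * ∑ i, (k i : ℝ) * Z j i))) ≤
      ENNReal.ofReal (16 * (α k ^ 2 + β k ^ 2) * M k) := by
    intro k hk
    obtain ⟨hc, hs⟩ := hdict k (hne k hk)
    obtain ⟨ha, hb⟩ := hMinusOneSqW_modeCoeff_le L hΘc (continuous_densityWave L k Real.continuous_cos)
      (continuous_densityWave L k Real.continuous_sin) (hM0 k hk) hc hs (α k) (β k)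
    calc _ ≤ ENNReal.ofReal (8 * (α k ^ 2 + β k ^ 2) * M k) +
          ENNReal.ofReal (8 * (α k ^ 2 + β k ^ 2) * M k) := add_le_add ha hb
      _ = _ := by
          rw [← ENNReal.ofReal_add (by have := hM0 k hk; positivity)
            (by have := hM0 k hk; positivity)]
          congr 1; ring
  -- Step 3: sum and identify
  have hterm : ∀ k ∈ S, L ^ 3 / 2 * (16 * (α k ^ 2 + β k ^ 2) * M k) =
      2 * CK * N * L ^ 5 / Real.pi ^ 2 * ((α k ^ 2 + β k ^ 2) / ∑ i, (k i : ℝ) ^ 2) := by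
    intro k hk
    have hn := nsq_pos_of_ne_zero (hne k hk)
    rw [hM]
    field_simp
    ring
  calc ENNReal.ofReal (L ^ 3 / 2) * ∑ k ∈ S,
        (hMinusOneSqW L Θ₀ (fun Z : Config N =>
            2 * (α k * ∑ j, Real.cos (2 * Real.pi / L * ∑ i, (k i : ℝ) * Z j i) +
              β k * ∑ j, Real.sin (2 * Real.pi / L * ∑ i, (k i : ℝ) * Z j i))) +
          hMinusOneSqW L Θ₀ (fun Z : Config N =>
            2 * (α k * ∑ j, Real.sin (2 * Real.pi / L * ∑ i, (k i : ℝ) * Z j i) -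
              β k * ∑ j, Real.cos (2 * Real.pi / L * ∑ i, (k i : ℝ) * Z j i))))
      ≤ ENNReal.ofReal (L ^ 3 / 2) * ∑ k ∈ S, ENNReal.ofReal (16 * (α k ^ 2 + β k ^ 2) * M k) := by
        gcongr with k hk
        exact h2 k hk
    _ = ENNReal.ofReal (∑ k ∈ S, L ^ 3 / 2 * (16 * (α k ^ 2 + β k ^ 2) * M k)) := by
        rw [← ENNReal.ofReal_sum_of_nonneg fun k hk => by have := hM0 k hk; positivity,
          ← ENNReal.ofReal_mul (by positivity), Finset.mul_sum]
    _ = _ := by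
        rw [Finset.sum_congr rfl hterm, ← Finset.mul_sum]

/-- **The tagged-mode sums under coefficient bounds.** If moreover `α_k² + β_k² = c_k²` with
`|c_k| ≤ A` for all `k` and `∑_{k ∈ T} c_k² ≤ P` for all finite `T`, then
`‖M‖²₋₁ ≤ (2 C_K N L⁵/π²)(96 ⌈L⌉ A² + P/⌈L⌉²)`. [folklore] -/
theorem hMinusOneSqW_modes_le_of_coeff_bounds (hL : 0 < L) {Θ₀ : Config N → ℝ} (hΘc : Continuous Θ₀)
    {CK : ℝ} (hCK : 0 ≤ CK)
    (hdict : ∀ k : Fin 3 → ℤ, k ≠ 0 →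
      hMinusOneSqW L Θ₀
          (fun X : Config N => ∑ j, Real.cos (2 * Real.pi / L * ∑ i, (k i : ℝ) * X j i)) ≤
        ENNReal.ofReal (CK * N / ((2 * Real.pi / L) ^ 2 * ∑ i, (k i : ℝ) ^ 2)) ∧
      hMinusOneSqW L Θ₀
          (fun X : Config N => ∑ j, Real.sin (2 * Real.pi / L * ∑ i, (k i : ℝ) * X j i)) ≤
        ENNReal.ofReal (CK * N / ((2 * Real.pi / L) ^ 2 * ∑ i, (k i : ℝ) ^ 2)))
    {S : Finset (Fin 3 → ℤ)} (hS0 : (0 : Fin 3 → ℤ) ∉ S) (hS : ∀ m ∈ S, -m ∉ S)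
    (α β c : (Fin 3 → ℤ) → ℝ) (hc : ∀ k, α k ^ 2 + β k ^ 2 = c k ^ 2) {A P : ℝ}
    (hA : ∀ k, |c k| ≤ A) (hP : ∀ T : Finset (Fin 3 → ℤ), ∑ k ∈ T, c k ^ 2 ≤ P) :
    hMinusOneSqW L (fun X : Config (N + 1) => Θ₀ (vecTail X))
        (fun X : Config (N + 1) => ∑ k ∈ S,
          (2 * (α k * ∑ j, Real.cos (2 * Real.pi / L * ∑ i, (k i : ℝ) * vecTail X j i) +
                β k * ∑ j, Real.sin (2 * Real.pi / L * ∑ i, (k i : ℝ) * vecTail X j i)) *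
              Real.cos (2 * Real.pi / L * ∑ i, (k i : ℝ) * X 0 i) +
            2 * (α k * ∑ j, Real.sin (2 * Real.pi / L * ∑ i, (k i : ℝ) * vecTail X j i) -
                β k * ∑ j, Real.cos (2 * Real.pi / L * ∑ i, (k i : ℝ) * vecTail X j i)) *
              Real.sin (2 * Real.pi / L * ∑ i, (k i : ℝ) * X 0 i))) ≤
      ENNReal.ofReal (2 * CK * N * L ^ 5 / Real.pi ^ 2 *
        (96 * ⌈L⌉₊ * A ^ 2 + P / (⌈L⌉₊ : ℝ) ^ 2)) := by
  refine (hMinusOneSqW_modes_le_latticeSum hL hΘc hCK hdict hS0 hS α β).trans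
    (ENNReal.ofReal_le_ofReal ?_)
  refine mul_le_mul_of_nonneg_left ?_ (by positivity)
  simp only [hc]
  exact sum_sq_div_nsq_le hA hP (Nat.one_le_ceil_iff.2 hL) S hS0

/-- **The arithmetic of the lattice sum** with `A = L⁻³κ`, `P = L⁻³ C_U κ`, `K₀ = ⌈L⌉`, `L ≥ 1`:
`(2C_K N L⁵/π²)(96⌈L⌉(L⁻³κ)² + L⁻³C_Uκ/⌈L⌉²) ≤ C_K (192κ² + C_Uκ) N`. [folklore] -/
theorem latticeSum_arith (hL1 : 1 ≤ L) {CK κ CU : ℝ} (hCK : 0 ≤ CK) (hκ : 0 ≤ κ) (hCU : 0 ≤ CU)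
    (N : ℕ) :
    2 * CK * N * L ^ 5 / Real.pi ^ 2 *
        (96 * ⌈L⌉₊ * ((L ^ 3)⁻¹ * κ) ^ 2 + (L ^ 3)⁻¹ * (CU * κ) / (⌈L⌉₊ : ℝ) ^ 2) ≤
      CK * (192 * κ ^ 2 + CU * κ) * N := by
  have hL : 0 < L := one_pos.trans_le hL1
  have hc1 : (L : ℝ) ≤ (⌈L⌉₊ : ℝ) := Nat.le_ceil L
  have hc2 : ((⌈L⌉₊ : ℕ) : ℝ) ≤ 2 * L := by
    have := Nat.ceil_lt_add_one hL.le
    linarith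
  have hN : (0 : ℝ) ≤ N := Nat.cast_nonneg N
  have hpi : 2 / Real.pi ^ 2 ≤ 1 := by
    rw [div_le_one (by positivity)]
    nlinarith [Real.pi_gt_three]
  have hIR : 96 * (⌈L⌉₊ : ℝ) * ((L ^ 3)⁻¹ * κ) ^ 2 ≤ 192 * κ ^ 2 / L ^ 5 := by
    rw [show 96 * (⌈L⌉₊ : ℝ) * ((L ^ 3)⁻¹ * κ) ^ 2 = (⌈L⌉₊ : ℝ) * (96 * κ ^ 2 / L ^ 6) by
      field_simp, show 192 * κ ^ 2 / L ^ 5 = (2 * L) * (96 * κ ^ 2 / L ^ 6) by field_simp; ring]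
    exact mul_le_mul_of_nonneg_right hc2 (by positivity)
  have hUV : (L ^ 3)⁻¹ * (CU * κ) / ((⌈L⌉₊ : ℕ) : ℝ) ^ 2 ≤ CU * κ / L ^ 5 := by
    rw [show (CU : ℝ) * κ / L ^ 5 = (L ^ 3)⁻¹ * (CU * κ) / L ^ 2 by field_simp]
    exact div_le_div_of_nonneg_left (by positivity) (by positivity)
      (pow_le_pow_left₀ hL.le hc1 2)
  calc 2 * CK * N * L ^ 5 / Real.pi ^ 2 *
        (96 * ⌈L⌉₊ * ((L ^ 3)⁻¹ * κ) ^ 2 + (L ^ 3)⁻¹ * (CU * κ) / (⌈L⌉₊ : ℝ) ^ 2)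
      ≤ 2 * CK * N * L ^ 5 / Real.pi ^ 2 * (192 * κ ^ 2 / L ^ 5 + CU * κ / L ^ 5) :=
        mul_le_mul_of_nonneg_left (add_le_add hIR hUV) (by positivity)
    _ = 2 / Real.pi ^ 2 * (CK * (192 * κ ^ 2 + CU * κ) * N) := by
        field_simp
    _ ≤ 1 * (CK * (192 * κ ^ 2 + CU * κ) * N) :=
        mul_le_mul_of_nonneg_right hpi (by positivity)
    _ = _ := one_mul _

/-- **The tagged-mode sums under the Fourier-type coefficient bounds.** With `|c_k| ≤ L⁻³κ`,
`∑_T c_k² ≤ L⁻³ C_U κ` (the bounds of the cell Fourier coefficients of `v^per`: sup bound and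
Parseval) and `L ≥ 1`: `‖M‖²₋₁ ≤ C_K (192κ² + C_Uκ) N`, uniformly in the index set `S`. [folklore] -/
theorem hMinusOneSqW_modes_le_of_fourier_bounds (hL1 : 1 ≤ L) {Θ₀ : Config N → ℝ}
    (hΘc : Continuous Θ₀) {CK : ℝ} (hCK : 0 ≤ CK)
    (hdict : ∀ k : Fin 3 → ℤ, k ≠ 0 →
      hMinusOneSqW L Θ₀
          (fun X : Config N => ∑ j, Real.cos (2 * Real.pi / L * ∑ i, (k i : ℝ) * X j i)) ≤
        ENNReal.ofReal (CK * N / ((2 * Real.pi / L) ^ 2 * ∑ i, (k i : ℝ) ^ 2)) ∧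
      hMinusOneSqW L Θ₀
          (fun X : Config N => ∑ j, Real.sin (2 * Real.pi / L * ∑ i, (k i : ℝ) * X j i)) ≤
        ENNReal.ofReal (CK * N / ((2 * Real.pi / L) ^ 2 * ∑ i, (k i : ℝ) ^ 2)))
    {S : Finset (Fin 3 → ℤ)} (hS0 : (0 : Fin 3 → ℤ) ∉ S) (hS : ∀ m ∈ S, -m ∉ S)
    (α β c : (Fin 3 → ℤ) → ℝ) (hc : ∀ k, α k ^ 2 + β k ^ 2 = c k ^ 2) {κ CU : ℝ} (hκ : 0 ≤ κ)
    (hCU : 0 ≤ CU) (hA : ∀ k, |c k| ≤ (L ^ 3)⁻¹ * κ)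
    (hP : ∀ T : Finset (Fin 3 → ℤ), ∑ k ∈ T, c k ^ 2 ≤ (L ^ 3)⁻¹ * (CU * κ)) :
    hMinusOneSqW L (fun X : Config (N + 1) => Θ₀ (vecTail X))
        (fun X : Config (N + 1) => ∑ k ∈ S,
          (2 * (α k * ∑ j, Real.cos (2 * Real.pi / L * ∑ i, (k i : ℝ) * vecTail X j i) +
                β k * ∑ j, Real.sin (2 * Real.pi / L * ∑ i, (k i : ℝ) * vecTail X j i)) *
              Real.cos (2 * Real.pi / L * ∑ i, (k i : ℝ) * X 0 i) +
            2 * (α k * ∑ j, Real.sin (2 * Real.pi / L * ∑ i, (k i : ℝ) * vecTail X j i) -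
                β k * ∑ j, Real.cos (2 * Real.pi / L * ∑ i, (k i : ℝ) * vecTail X j i)) *
              Real.sin (2 * Real.pi / L * ∑ i, (k i : ℝ) * X 0 i))) ≤
      ENNReal.ofReal (CK * (192 * κ ^ 2 + CU * κ) * N) :=
  (hMinusOneSqW_modes_le_of_coeff_bounds (one_pos.trans_le hL1) hΘc hCK hdict hS0 hS α β c hc hA
    hP).trans (ENNReal.ofReal_le_ofReal (latticeSum_arith hL1 hCK hκ hCU N))

end Summit.AtomisticToContinuum.BoseEinsteinCondensation.Theorems.CorrectorClosure.ResidueAreaLaw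

end
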